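import Literature.Analysis.FunctionSpaces.TorusConvectionLaplacianNormSq
import HarnessLib

/-!
# The `H³` norm of the inertial term `(u·∇)u` by the `H⁴` norm on `T³`, with `W^{1,∞}` coefficients

Analysis/FunctionSpaces support file (everything proved; no definitions, no named facts), sequel of
`TorusConvectionGradNormSq.lean` (`H¹` of `(u·∇)u`) and `TorusConvectionLaplacianNormSq.lean` (`H²` of
`(u·∇)u`: the Leibniz rule `∂ₘ((v·∇)w) = (v·∇)∂ₘw + (∂ₘv·∇)w`, the two bounds
`‖∇((v·∇)w)‖₂² ≤ 2d M₀² ‖Δw‖₂² + 2d² M₁² ‖∇w‖₂²` / `… + 2d² M₁² ‖∇v‖₂²` under sup bounds of `v` and of the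
first derivatives of `v`, resp. `w`, and the sup bound `‖∂ₖu‖² ≤ K (‖Δu‖₂² + ‖∇Δu‖₂²)` on `T³`). It proves
the next rung of the ladder, the `L²` norm of the GRADIENT OF THE LAPLACIAN of the convective term — the
`H³`-level instance of "`H^k(T³)` is an algebra" used in the `k = 4` step of the regularity ladder of strong
solutions (Robinson–Rodrigo–Sadowski 2016, proof of Thm 7.1, estimate (7.3) with `k = 4`; Constantin–Foias
1988, Ch. 6 and Thm 10.6), in the form that is AFFINE in the top-order quantity `‖ΔΔu‖₂²` once
`‖u‖_∞ ≤ M`, `‖∂ₖu‖_∞ ≤ Λ` and `‖Δu‖₂²`, `‖∇Δu‖₂²` are controlled: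

* `Torus.gradNormSq_partialDeriv_le_integral_norm_laplacian_sq`,
  `Torus.integral_norm_laplacian_partialDeriv_sq_le`, `Torus.laplacian_partialDeriv_eq`,
  `Torus.gradNormSq_laplacian_partialDeriv_le`, `Torus.gradNormSq_partialDeriv_partialDeriv_le`,
  `Torus.integral_norm_laplacian_partialDeriv_partialDeriv_sq_le` — one direction against the full seminorm:
  `‖∇∂ₖu‖₂² ≤ ‖Δu‖₂²`, `‖Δ∂ₖu‖₂² ≤ ‖∇Δu‖₂²`, `Δ∂ₖ = ∂ₖΔ`, `‖∇Δ∂ₖu‖₂² ≤ ‖ΔΔu‖₂²`, `‖∇∂ⱼ∂ₖu‖₂² ≤ ‖∇Δu‖₂²`,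
  `‖Δ∂ⱼ∂ₖu‖₂² ≤ ‖ΔΔu‖₂²`;
* `Torus.norm_partialDeriv_partialDeriv_sq_le_of_isSmooth` — on `T³`,
  `‖∂ⱼ∂ₖu(x)‖² ≤ K (‖∇Δu‖₂² + ‖ΔΔu‖₂²)` for every smooth `u` (the sup-norm embedding applied to the
  zero-mean field `∂ⱼ∂ₖu`): the `W^{2,∞} ⊂ H⁴` bound;
* `Torus.gradNormSq_laplacian_convect_self_le` — **the estimate**: on `T^d` with `card d = 3` there is
  `C ≥ 0` with
  `‖∇Δ((u·∇)u)‖₂² ≤ C ((M² + ‖Δu‖₂²) ‖ΔΔu‖₂² + (Λ² + ‖Δu‖₂²) ‖∇Δu‖₂²)`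
  for every smooth `u` with `‖u‖ ≤ M` and `‖∂ₖu‖ ≤ Λ` pointwise
  (`‖∇·‖₂² = Torus.gradNormSq`, `‖Δ·‖₂² = ∫ ‖Torus.laplacian ·‖²`).

Proof of the estimate: `‖∇ΔB‖₂² = ∑ₘ ‖Δ∂ₘB‖₂² = ∑ₘ ∑ₖ ‖∇∂ₖ∂ₘB‖₂²` and, by Leibniz twice,
`∂ₖ∂ₘB = (u·∇)∂ₖ∂ₘu + (∂ₖu·∇)∂ₘu + (∂ₘu·∇)∂ₖu + (∂ₖ∂ₘu·∇)u`; the four gradients are bounded by the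
two `‖∇((v·∇)w)‖₂²` bounds with the sup norms `M` (of `u`), `Λ` (of `∂u`) and `D₂² = K (‖∇Δu‖₂² + ‖ΔΔu‖₂²)`
(of `∂∂u`), which multiplies only `L²` quantities of the levels of `‖∇u‖₂`, `‖Δu‖₂` — so the bound is
affine in `‖ΔΔu‖₂²`, which is what the `H⁴` Grönwall step needs. No zero-mean hypothesis on `u` (the sup norms are
hypotheses). Consumed by the `H⁴` smoothing estimate of classical Navier–Stokes solutions
(`FluidPDE/TorusClassicalNSH4Smoothing.lean`).

## Mathlib / tree search

Tree (reused): `Torus.partialDeriv_convect_self_eq_add` (`TorusConvectionGradNormSq`),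
`Torus.partialDeriv_convect_eq_add_convect`, `Torus.gradNormSq_laplacian_eq_sum`,
`Torus.norm_partialDeriv_sq_le_of_isSmooth`, `Torus.gradNormSq_add_le`,
`Torus.gradNormSq_convect_le_of_norm_left_le`, `Torus.gradNormSq_convect_le_of_norm_right_le`
(`TorusConvectionLaplacianNormSq`), `Torus.sum_gradNormSq_partialDeriv_eq` (`TorusEnstrophyTrilinear`),
`Torus.partialDeriv_laplacian_comm` (`TorusInverseLaplacianCalculus`), `Torus.partialDeriv_add`
(`TorusTestFunction`); Mathlib `Finset.single_le_sum`. Searched `gradNormSq (laplacian (convect`,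
`laplacian_convect`, `partialDeriv_partialDeriv_sq_le`, `H3 algebra`: no `H³` bound of the inertial term on
the torus in the tree.

## References

* J. C. Robinson, J. L. Rodrigo, W. Sadowski, *The Three-Dimensional Navier–Stokes Equations*,
  CUP 2016, proof of Thm 7.1 ((7.3), `H^k` is an algebra, `k ≥ 2`). [RobinsonRodrigoSadowskiCUP2016]
* P. Constantin, C. Foias, *Navier–Stokes Equations*, Univ. Chicago Press 1988, Ch. 6 and Ch. 10,
  Thm 10.6. [ConstantinFoiasNSE1988]
-/

noncomputable section

open _root_.MeasureTheory Set Filter Function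
open scoped ENNReal NNReal InnerProductSpace ContDiff

namespace Literature.Analysis.FunctionSpaces

namespace Torus

variable {d : Type*} [Fintype d] [DecidableEq d]

/-! ### One direction against the full seminorm -/

/-- **`‖∇∂ₖu‖₂² ≤ ‖Δu‖₂²`** (one term of `∑ₘ ‖∇∂ₘu‖₂² = ‖Δu‖₂²`, `Torus.sum_gradNormSq_partialDeriv_eq`;
the sharp form of `Torus.gradNormSq_partialDeriv_le`, which carries a factor `d`). [folklore] -/
theorem gradNormSq_partialDeriv_le_integral_norm_laplacian_sq {u : UnitAddTorus d → EuclideanSpace ℝ d}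
    (hu : IsSmooth u) (k : d) : gradNormSq (partialDeriv k u) ≤ ∫ x, ‖laplacian u x‖ ^ 2 := by
  rw [← sum_gradNormSq_partialDeriv_eq hu]
  exact Finset.single_le_sum (f := fun m => gradNormSq (partialDeriv m u))
    (fun m _ => gradNormSq_nonneg (partialDeriv m u)) (Finset.mem_univ k)

/-- **`‖Δ∂ₖu‖₂² ≤ ‖∇Δu‖₂²`** (one term of `‖∇Δu‖₂² = ∑ₘ ‖Δ∂ₘu‖₂²`, `Torus.gradNormSq_laplacian_eq_sum`).
[folklore] -/
theorem integral_norm_laplacian_partialDeriv_sq_le {u : UnitAddTorus d → EuclideanSpace ℝ d}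
    (hu : IsSmooth u) (k : d) :
    ∫ x, ‖laplacian (partialDeriv k u) x‖ ^ 2 ≤ gradNormSq (laplacian u) := by
  rw [gradNormSq_laplacian_eq_sum hu]
  exact Finset.single_le_sum (f := fun m => ∫ x, ‖laplacian (partialDeriv m u) x‖ ^ 2)
    (fun m _ => integral_nonneg fun x => sq_nonneg _) (Finset.mem_univ k)

/-- **`Δ∂ₖu = ∂ₖΔu`** as functions (Schwarz, `Torus.partialDeriv_laplacian_comm`). [folklore] -/
theorem laplacian_partialDeriv_eq {u : UnitAddTorus d → EuclideanSpace ℝ d} (hu : IsSmooth u) (k : d) :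
    laplacian (partialDeriv k u) = partialDeriv k (laplacian u) :=
  funext fun x => (partialDeriv_laplacian_comm hu k x).symm

/-- **`‖∇Δ∂ₖu‖₂² ≤ ‖ΔΔu‖₂²`** (`Δ∂ₖ = ∂ₖΔ` and `‖∇∂ₖv‖₂² ≤ ‖Δv‖₂²` for `v = Δu`). [folklore] -/
theorem gradNormSq_laplacian_partialDeriv_le {u : UnitAddTorus d → EuclideanSpace ℝ d} (hu : IsSmooth u)
    (k : d) : gradNormSq (laplacian (partialDeriv k u)) ≤ ∫ x, ‖laplacian (laplacian u) x‖ ^ 2 := by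
  rw [laplacian_partialDeriv_eq hu k]
  exact gradNormSq_partialDeriv_le_integral_norm_laplacian_sq hu.laplacian k

/-- **`‖∇∂ⱼ∂ₖu‖₂² ≤ ‖∇Δu‖₂²`** (`‖∇∂ⱼv‖₂² ≤ ‖Δv‖₂²` for `v = ∂ₖu`, then `‖Δ∂ₖu‖₂² ≤ ‖∇Δu‖₂²`).
[folklore] -/
theorem gradNormSq_partialDeriv_partialDeriv_le {u : UnitAddTorus d → EuclideanSpace ℝ d} (hu : IsSmooth u)
    (j k : d) : gradNormSq (partialDeriv j (partialDeriv k u)) ≤ gradNormSq (laplacian u) :=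
  (gradNormSq_partialDeriv_le_integral_norm_laplacian_sq (hu.partialDeriv k) j).trans
    (integral_norm_laplacian_partialDeriv_sq_le hu k)

/-- **`‖Δ∂ⱼ∂ₖu‖₂² ≤ ‖ΔΔu‖₂²`** (`‖Δ∂ⱼv‖₂² ≤ ‖∇Δv‖₂²` for `v = ∂ₖu`, then `‖∇Δ∂ₖu‖₂² ≤ ‖ΔΔu‖₂²`).
[folklore] -/
theorem integral_norm_laplacian_partialDeriv_partialDeriv_sq_le {u : UnitAddTorus d → EuclideanSpace ℝ d}
    (hu : IsSmooth u) (j k : d) :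
    ∫ x, ‖laplacian (partialDeriv j (partialDeriv k u)) x‖ ^ 2 ≤ ∫ x, ‖laplacian (laplacian u) x‖ ^ 2 :=
  (integral_norm_laplacian_partialDeriv_sq_le (hu.partialDeriv k) j).trans
    (gradNormSq_laplacian_partialDeriv_le hu k)

/-! ### The sup norm of the second derivatives by `‖∇Δu‖₂² + ‖ΔΔu‖₂²` on `T³` -/

/-- **Sup norm of the Hessian by `‖∇Δu‖₂² + ‖ΔΔu‖₂²` on `T³`**: on `T^d` with `card d = 3` there is `K > 0`
such that `‖∂ⱼ∂ₖu(x)‖² ≤ K (‖∇Δu‖₂² + ‖ΔΔu‖₂²)` for every smooth `u : T^d → ℝ^d`, all `j, k` and every `x`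
— the bound `‖∂ⱼv‖² ≤ K (‖Δv‖₂² + ‖∇Δv‖₂²)` (`Torus.norm_partialDeriv_sq_le_of_isSmooth`) for `v = ∂ₖu`
together with `‖Δ∂ₖu‖₂² ≤ ‖∇Δu‖₂²` and `‖∇Δ∂ₖu‖₂² ≤ ‖ΔΔu‖₂²`. No zero-mean hypothesis on `u` is needed.
This is the `W^{2,∞} ⊂ H⁴` bound of the `k = 4` step of the regularity ladder. [folklore] -/
theorem norm_partialDeriv_partialDeriv_sq_le_of_isSmooth (hd : Fintype.card d = 3) :
    ∃ K : ℝ, 0 < K ∧ ∀ u : UnitAddTorus d → EuclideanSpace ℝ d, IsSmooth u →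
      ∀ (j k : d) (x : UnitAddTorus d),
        ‖partialDeriv j (partialDeriv k u) x‖ ^ 2 ≤
          K * (gradNormSq (laplacian u) + ∫ y, ‖laplacian (laplacian u) y‖ ^ 2) := by
  obtain ⟨K, hK, hsup⟩ := norm_partialDeriv_sq_le_of_isSmooth (d := d) hd
  refine ⟨K, hK, fun u hu j k x => ?_⟩
  exact (hsup (partialDeriv k u) (hu.partialDeriv k) j x).trans
    (mul_le_mul_of_nonneg_left (add_le_add (integral_norm_laplacian_partialDeriv_sq_le hu k)
      (gradNormSq_laplacian_partialDeriv_le hu k)) hK.le)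

/-! ### The estimate -/

/-- **`‖∇Δ((u·∇)u)‖₂² ≤ C ((M² + ‖Δu‖₂²) ‖ΔΔu‖₂² + (Λ² + ‖Δu‖₂²) ‖∇Δu‖₂²)` on `T³` when `‖u‖ ≤ M`,
`‖∂ₖu‖ ≤ Λ`** (the `H³`-level instance of "`H^k(T³)` is an algebra", Robinson–Rodrigo–Sadowski 2016, proof
of Thm 7.1, (7.3) with `k = 4`; Constantin–Foias 1988, Ch. 6): on `T^d` with `card d = 3` there is `C ≥ 0`
such that for every smooth `u : T^d → ℝ^d` and all `M, Λ` with `‖u(x)‖ ≤ M`, `‖∂ₖu(x)‖ ≤ Λ`,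
`gradNormSq (Δ((u·∇)u)) ≤ C ((M² + ∫ ‖Δu‖²) ∫ ‖ΔΔu‖² + (Λ² + ∫ ‖Δu‖²) gradNormSq (Δu))`.
Proof: `‖∇ΔB‖₂² = ∑ₘ ‖Δ∂ₘB‖₂² = ∑ₘ∑ₖ ‖∇∂ₖ∂ₘB‖₂²`,
`∂ₖ∂ₘB = (u·∇)∂ₖ∂ₘu + (∂ₖu·∇)∂ₘu + (∂ₘu·∇)∂ₖu + (∂ₖ∂ₘu·∇)u` (Leibniz twice), the bounds
`gradNormSq_convect_le_of_norm_left_le` / `…_right_le` with the sup norms `M`, `Λ` and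
`‖∂ₖ∂ₘu‖² ≤ K (‖∇Δu‖₂² + ‖ΔΔu‖₂²)` (`norm_partialDeriv_partialDeriv_sq_le_of_isSmooth`), and the one-direction
bounds above; `C = 1728 (1 + K)`. The bound is affine in `∫ ‖ΔΔu‖²`.
[cite: RobinsonRodrigoSadowskiCUP2016, proof of Thm 7.1 (7.3)] -/
theorem gradNormSq_laplacian_convect_self_le (hd : Fintype.card d = 3) :
    ∃ C : ℝ, 0 ≤ C ∧ ∀ u : UnitAddTorus d → EuclideanSpace ℝ d, IsSmooth u → ∀ {M Λ : ℝ},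
      (∀ x, ‖u x‖ ≤ M) → (∀ (k : d) (x : UnitAddTorus d), ‖partialDeriv k u x‖ ≤ Λ) →
      gradNormSq (laplacian (convect u u)) ≤
        C * ((M ^ 2 + ∫ x, ‖laplacian u x‖ ^ 2) * (∫ x, ‖laplacian (laplacian u) x‖ ^ 2) +
          (Λ ^ 2 + ∫ x, ‖laplacian u x‖ ^ 2) * gradNormSq (laplacian u)) := by
  obtain ⟨K, hK, hsup⟩ := norm_partialDeriv_partialDeriv_sq_le_of_isSmooth (d := d) hd
  refine ⟨1728 * (1 + K), by positivity, fun u hu {M Λ} hM hΛ => ?_⟩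
  set Y : ℝ := ∫ x, ‖laplacian u x‖ ^ 2
  set Z : ℝ := gradNormSq (laplacian u)
  set W : ℝ := ∫ x, ‖laplacian (laplacian u) x‖ ^ 2
  have hY0 : 0 ≤ Y := integral_nonneg fun x => sq_nonneg _
  have hZ0 : 0 ≤ Z := gradNormSq_nonneg _
  have hW0 : 0 ≤ W := integral_nonneg fun x => sq_nonneg _
  have hB : IsSmooth (convect u u) := hu.convect hu
  have hD : ∀ m, IsSmooth (partialDeriv m u) := fun m => hu.partialDeriv m
  have hDD : ∀ k m, IsSmooth (partialDeriv k (partialDeriv m u)) := fun k m => (hD m).partialDeriv k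
  -- the sup bound of the second derivatives, `‖∂ₖ∂ₘu‖ ≤ D₂`, `D₂² = K (Z + W)`
  set D₂ : ℝ := Real.sqrt (K * (Z + W)) with hD₂
  have hD₂2 : D₂ ^ 2 = K * (Z + W) := Real.sq_sqrt (by positivity)
  have hD₂x : ∀ (k m : d) (x : UnitAddTorus d), ‖partialDeriv k (partialDeriv m u) x‖ ≤ D₂ := by
    intro k m x
    rw [hD₂, ← Real.sqrt_sq (norm_nonneg (partialDeriv k (partialDeriv m u) x))]
    exact Real.sqrt_le_sqrt (hsup u hu k m x)
  -- the four terms of `∂ₖ∂ₘ((u·∇)u)`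
  have hT1 : ∀ k m, gradNormSq (convect u (partialDeriv k (partialDeriv m u))) ≤
      6 * M ^ 2 * W + 18 * Λ ^ 2 * Z := by
    intro k m
    have h := gradNormSq_convect_le_of_norm_left_le hu (hDD k m) hM hΛ
    have h1 : ∫ x, ‖laplacian (partialDeriv k (partialDeriv m u)) x‖ ^ 2 ≤ W :=
      integral_norm_laplacian_partialDeriv_partialDeriv_sq_le hu k m
    have h2 : gradNormSq (partialDeriv k (partialDeriv m u)) ≤ Z :=
      gradNormSq_partialDeriv_partialDeriv_le hu k m
    rw [hd] at h
    push_cast at h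
    linarith [mul_le_mul_of_nonneg_left h1 (sq_nonneg M), mul_le_mul_of_nonneg_left h2 (sq_nonneg Λ)]
  have hT2 : ∀ k m, gradNormSq (convect (partialDeriv k u) (partialDeriv m u)) ≤
      6 * Λ ^ 2 * Z + 18 * (K * (Z + W)) * Y := by
    intro k m
    have h := gradNormSq_convect_le_of_norm_right_le (hD k) (hD m) (hΛ k) (fun j x => hD₂x j m x)
    have h1 : ∫ x, ‖laplacian (partialDeriv m u) x‖ ^ 2 ≤ Z := integral_norm_laplacian_partialDeriv_sq_le hu m
    have h2 : gradNormSq (partialDeriv k u) ≤ Y :=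
      gradNormSq_partialDeriv_le_integral_norm_laplacian_sq hu k
    rw [hd, hD₂2] at h
    push_cast at h
    have hKZW : 0 ≤ K * (Z + W) := by positivity
    linarith [mul_le_mul_of_nonneg_left h1 (sq_nonneg Λ), mul_le_mul_of_nonneg_left h2 hKZW]
  have hT4 : ∀ k m, gradNormSq (convect (partialDeriv k (partialDeriv m u)) u) ≤
      6 * (K * (Z + W)) * Y + 18 * Λ ^ 2 * Z := by
    intro k m
    have h := gradNormSq_convect_le_of_norm_right_le (hDD k m) hu (hD₂x k m) hΛ
    have h1 : ∫ x, ‖laplacian u x‖ ^ 2 ≤ Y := le_rfl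
    have h2 : gradNormSq (partialDeriv k (partialDeriv m u)) ≤ Z :=
      gradNormSq_partialDeriv_partialDeriv_le hu k m
    rw [hd, hD₂2] at h
    push_cast at h
    have hKZW : 0 ≤ K * (Z + W) := by positivity
    linarith [mul_le_mul_of_nonneg_left h1 hKZW, mul_le_mul_of_nonneg_left h2 (sq_nonneg Λ)]
  -- Leibniz twice and `‖∇(a + b)‖₂² ≤ 2‖∇a‖₂² + 2‖∇b‖₂²`
  set R : ℝ := 6 * M ^ 2 * W + 48 * Λ ^ 2 * Z + 42 * (K * (Z + W)) * Y with hR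
  have hkm : ∀ k m, gradNormSq (partialDeriv k (partialDeriv m (convect u u))) ≤ 4 * R := by
    intro k m
    have hP : IsSmooth (convect u (partialDeriv m u)) := hu.convect (hD m)
    have hQ : IsSmooth (convect (partialDeriv m u) u) := (hD m).convect hu
    have hPQ : partialDeriv m (convect u u) =
        convect u (partialDeriv m u) + convect (partialDeriv m u) u := by
      funext x
      rw [Pi.add_apply]
      exact partialDeriv_convect_self_eq_add hu m x
    have hPk : partialDeriv k (convect u (partialDeriv m u)) =
        convect u (partialDeriv k (partialDeriv m u)) + convect (partialDeriv k u) (partialDeriv m u) := by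
      funext x
      rw [Pi.add_apply]
      exact partialDeriv_convect_eq_add_convect hu (hD m) k x
    have hQk : partialDeriv k (convect (partialDeriv m u) u) =
        convect (partialDeriv m u) (partialDeriv k u) + convect (partialDeriv k (partialDeriv m u)) u := by
      funext x
      rw [Pi.add_apply]
      exact partialDeriv_convect_eq_add_convect (hD m) hu k x
    have h1 := gradNormSq_add_le (hP.partialDeriv k) (hQ.partialDeriv k)
    have h2 := gradNormSq_add_le (hu.convect (hDD k m)) ((hD k).convect (hD m))
    have h3 := gradNormSq_add_le ((hD m).convect (hD k)) ((hDD k m).convect hu)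
    rw [← hPk] at h2
    rw [← hQk] at h3
    rw [hPQ, partialDeriv_add (hP.isContDiff (by simp)) (hQ.isContDiff (by simp)) k]
    have e1 := hT1 k m
    have e2 := hT2 k m
    have e3 := hT2 m k
    have e4 := hT4 k m
    rw [hR]
    linarith
  -- sum over the two directions
  have hm : ∀ m, ∫ x, ‖laplacian (partialDeriv m (convect u u)) x‖ ^ 2 ≤ 3 * (4 * R) := by
    intro m
    rw [← sum_gradNormSq_partialDeriv_eq (hB.partialDeriv m)]
    calc ∑ k, gradNormSq (partialDeriv k (partialDeriv m (convect u u))) ≤ ∑ _k : d, 4 * R :=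
          Finset.sum_le_sum fun k _ => hkm k m
      _ = 3 * (4 * R) := by rw [Finset.sum_const, Finset.card_univ, hd, nsmul_eq_mul]; norm_num
  have hsum : gradNormSq (laplacian (convect u u)) ≤ 3 * (3 * (4 * R)) := by
    rw [gradNormSq_laplacian_eq_sum hB]
    calc ∑ m, ∫ x, ‖laplacian (partialDeriv m (convect u u)) x‖ ^ 2 ≤ ∑ _m : d, 3 * (4 * R) :=
          Finset.sum_le_sum fun m _ => hm m
      _ = 3 * (3 * (4 * R)) := by rw [Finset.sum_const, Finset.card_univ, hd, nsmul_eq_mul]; norm_num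
  refine hsum.trans ?_
  rw [hR]
  have h1 : 0 ≤ M ^ 2 * W := mul_nonneg (sq_nonneg M) hW0
  have h2 : 0 ≤ Λ ^ 2 * Z := mul_nonneg (sq_nonneg Λ) hZ0
  have h3 : 0 ≤ Y * W := mul_nonneg hY0 hW0
  have h4 : 0 ≤ Y * Z := mul_nonneg hY0 hZ0
  have h5 : 0 ≤ K * (M ^ 2 * W) := mul_nonneg hK.le h1
  have h6 : 0 ≤ K * (Λ ^ 2 * Z) := mul_nonneg hK.le h2
  have h7 : 0 ≤ K * (Y * W) := mul_nonneg hK.le h3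
  have h8 : 0 ≤ K * (Y * Z) := mul_nonneg hK.le h4
  linarith

end Torus

end Literature.Analysis.FunctionSpaces

end
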